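import Mathlib
import Summits.NavierStokesRegularity.NavierStokesRegularity.Theorems.EulerZoomLiouvillePowerGaugeEulerLiouvilleSelfSimilarKelvinCompactVorticity
import Summits.NavierStokesRegularity.NavierStokesRegularity.Theorems.EulerZoomLiouvillePowerGaugeEulerLiouvilleSelfSimilarEndpointMemberFull
import Summits.NavierStokesRegularity.NavierStokesRegularity.Theorems.EulerZoomLiouvillePowerGaugeEulerLiouvilleSelfSimilarVorticity
import HarnessLib.Audit

/-!
# Rung C1 of the crux `EulerZoomLiouville.PowerGaugeEulerLiouville` at the endpoint `ρ = 1/2`: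
# NO SMOOTH SELF-SIMILAR EULER COLLAPSE AT THE ENERGY-CONSERVING SCALING IN SEREGIN'S CLASS

Route №10 `EulerZoomLiouville` (NavierStokesRegularity), crux E = stmt-NavierStokesRegularity-19832,
registered residue `stub_selfSimilarExtremal` (skeleton v9, line `birth`): exactly self-similar
members with an extremal profile.  At the energy-conserving endpoint `ρ = 1/2` (`γ = 2/5`,
Chae–Shvydkoy `α = N/2`) extremality `L^{2ρ−1}∫_{B_L}|V|² ≥ ε` is automatic for `V ≠ 0`, and the
member has finite conserved energy; the printed state of the art is Chae–Shvydkoy 2013 Thm 3.1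
(power spread, ported by the lineage as `selfSimilar_half_ae_eq_zero_of_powerSpread'`) and
Chae–Wolf 2020 Cor. 1.5 (Type-I `W^{1,∞}` solutions; typed as the NAMED FACT
`chaeWolf2020_dss_energyConservingScale`, undischarged).

* `selfSimilar_half_ae_eq_zero_of_smoothProfile` — **THE CLASSICAL ENDPOINT STRATUM, UNCONDITIONAL**:
  crux hypotheses VERBATIM at `ρ = 1/2` + exact self-similarity + a classical profile
  (`IsSelfSimilarEulerProfile (2/5) 0 V P`) with `V` smooth, bounded, bounded gradient tending to
  `0` at infinity ⇒ `u = 0` a.e.  Mechanism (this lineage, new): `V ∈ L²` (`A`-gauge) ⇒ shell drain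
  `L^{−4}` (`shell_energy_decay_half`, class LEI + Riesz pressure formula derived from the crux
  hypotheses) ⇒ the SELF-SIMILAR KELVIN LAW at spatial infinity (`…SelfSimilarKelvin`,
  `…KelvinFarField`, `…KelvinCompactVorticity`: circulation along the outgoing far trajectories of
  `γy + V` decays like `e^{−s/5}` while finite energy with a power tail forces faster decay) ⇒
  `curl V` compactly supported ⇒ trivial (`selfSimilar_ae_eq_zero_of_hasCompactSupport_curl`).

WHERE IT SITS: this is Chae–Wolf's Cor. 1.5 in the self-similar case, under the extra mild
hypothesis `DV → 0` at infinity (Chae–Wolf need only `V ∈ W^{1,∞}`; their proof uses Wolf's local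
pressure projection and weighted Calderón–Zygmund bounds), by an elementary Lagrangian route that
the tree can check.  It does NOT use the outgoing property of CIV 2026 (the core may recirculate).

WHAT THIS IS NOT: not NS, not E, not rung C1, not the endpoint in the weak class — profiles that
are merely `H¹_loc` (the class) are untouched, as is the whole window `0 < ρ < 1/2`, where the
Kelvin exponent `1 − 5γ/2 < 0` only reproduces energy saturation.

## References

* D. Chae, J. Wolf, Comm. Math. Phys. 376 (2020) = arXiv:1706.02020, Cor. 1.5. [ChaeWolf2020EulerTypeI]
* P. Constantin, M. Ignatova, V. Vicol, arXiv:2602.17570 (2026), §3.4.2. [ConstantinIgnatovaVicol2026Putative]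
* D. Chae, R. Shvydkoy, ARMA 209 (2013) = arXiv:1201.6009, §3.1 Thm 3.1. [ChaeShvydkoy2013]
-/

noncomputable section

-- flat `Theorems/<Route><Decl>…` files of one crux share the namespace of the crux (tree convention)
set_option linter.dupNamespace false

open MeasureTheory Set Filter Topology Metric Function InnerProductSpace
open scoped RealInnerProductSpace NNReal ENNReal ContDiff

namespace Summit.NavierStokesRegularity.NavierStokesRegularity.Theorems.PowerGaugeEulerLiouville.Kelvin

open Literature.Analysis Literature.Analysis.FluidPDE

variable {V : EuclideanSpace ℝ (Fin 3) → EuclideanSpace ℝ (Fin 3)}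

/-! ### The classical endpoint stratum of `stub_selfSimilarExtremal` -/

/-- **No smooth finite-energy self-similar Euler collapse at the energy-conserving scaling, in
Seregin's class — the CLASSICAL ENDPOINT STRATUM of `stub_selfSimilarExtremal`.**  Let
`(u, p, H, c)` satisfy the three hypotheses of the crux `PowerGaugeEulerLiouville` at `ρ = 1/2`
and be exactly self-similar (`γ = 1/(2+1/2) = 2/5`) with a classical profile
(`IsSelfSimilarEulerProfile γ 0 V P`) such that `V` is smooth and bounded with bounded gradient
tending to `0` at infinity.  Then `u = 0` a.e. on the slab.  (At `ρ = 1/2` the registered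
hypothesis `IsExtremalProfile (1/2) V` is automatic for `V ≠ 0`, so this is the whole classical
part of the endpoint case of the stub.)  Proof: `V ∈ L²` (`A`-gauge), the shell energies drain
like `L^{−4}` (`shell_energy_decay_half`, from the class LEI and the Riesz pressure formula, both
derived from the crux hypotheses), the self-similar Kelvin law at spatial infinity makes `curl V`
compactly supported (`hasCompactSupport_curl_of_shellDecay`), and a classical profile with
compactly supported vorticity is trivial in the class
(`selfSimilar_ae_eq_zero_of_hasCompactSupport_curl`).  This is the self-similar case of
Chae–Wolf, CMP 376 (2020), Cor. 1.5 (typed in the tree as the NAMED FACT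
`chaeWolf2020_dss_energyConservingScale`), here UNCONDITIONAL, by a different (Lagrangian,
elementary) route, under the extra mild hypothesis `DV → 0` at infinity.
[cite: ChaeWolf2020EulerTypeI, Cor. 1.5; ConstantinIgnatovaVicol2026Putative, §3.4.2 Remark 3.6] -/
theorem selfSimilar_half_ae_eq_zero_of_smoothProfile
    {u : ℝ → EuclideanSpace ℝ (Fin 3) → EuclideanSpace ℝ (Fin 3)}
    {p : ℝ → EuclideanSpace ℝ (Fin 3) → ℝ}
    {H : ℝ → EuclideanSpace ℝ (Fin 3) → EuclideanSpace ℝ (Fin 3) →L[ℝ] EuclideanSpace ℝ (Fin 3)}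
    {c : ℝ≥0} {P : EuclideanSpace ℝ (Fin 3) → ℝ}
    (hsw : IsSuitableWeakSolutionOn (slab (EuclideanSpace ℝ (Fin 3)) (Iio 0) isOpen_Iio) 0 0 u p)
    (hH : HasWeakSpatialGradientOn (slab (EuclideanSpace ℝ (Fin 3)) (Iio 0) isOpen_Iio) u H)
    (hgauge : ∀ a : ℝ, 0 < a →
      ENNReal.ofReal (a ^ (2 * (1 / 2 : ℝ))) * cknA a (0 : ℝ × EuclideanSpace ℝ (Fin 3)) u +
          ENNReal.ofReal (a ^ (1 / 2 : ℝ)) * cknE a (0 : ℝ × EuclideanSpace ℝ (Fin 3)) H +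
        ENNReal.ofReal (a ^ (2 * (1 / 2 : ℝ))) * cknD a (0 : ℝ × EuclideanSpace ℝ (Fin 3)) p ≤
          (c : ℝ≥0∞))
    (hu : ∀ τ : ℝ, τ < 0 → u τ = selfSimilarCollapse (1 / (2 + (1 / 2 : ℝ))) 0 V τ)
    (hp : ∀ τ : ℝ, τ < 0 → p τ = selfSimilarCollapsePressure (1 / (2 + (1 / 2 : ℝ))) 0 P τ)
    (hprof : IsSelfSimilarEulerProfile (1 / (2 + (1 / 2 : ℝ))) 0 V P)
    (hV : ContDiff ℝ ∞ V) {M : ℝ} (hM : ∀ y, ‖V y‖ ≤ M) {K : ℝ} (hK : ∀ y, ‖fderiv ℝ V y‖ ≤ K)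
    (hDV : Tendsto (fderiv ℝ V) (cocompact (EuclideanSpace ℝ (Fin 3))) (𝓝 0)) :
    uncurry u =ᵐ[volume.restrict (Iio (0 : ℝ) ×ˢ (univ : Set (EuclideanSpace ℝ (Fin 3))))] 0 := by
  have hγ : (1 / (2 + (1 / 2 : ℝ)) : ℝ) = 2 / 5 := by norm_num
  -- the gauges separately
  have hA : ∀ a : ℝ, 0 < a → ENNReal.ofReal (a ^ (2 * (1 / 2 : ℝ))) *
      cknA a (0 : ℝ × EuclideanSpace ℝ (Fin 3)) u ≤ (c : ℝ≥0∞) :=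
    fun a ha => le_trans (le_trans le_self_add le_self_add) (hgauge a ha)
  have hD : ∀ a : ℝ, 0 < a → ENNReal.ofReal (a ^ (2 * (1 / 2 : ℝ))) *
      cknD a (0 : ℝ × EuclideanSpace ℝ (Fin 3)) p ≤ (c : ℝ≥0∞) :=
    fun a ha => le_trans le_add_self (hgauge a ha)
  -- measurability of `u`, `p` on the slab and of the profiles
  have hum : AEStronglyMeasurable (uncurry u)
      (volume.restrict (Iio (0 : ℝ) ×ˢ (univ : Set (EuclideanSpace ℝ (Fin 3))))) := by
    have := hH.locallyIntegrableOn.aestronglyMeasurable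
    simpa [slab] using this
  have hpm : AEStronglyMeasurable (uncurry p)
      (volume.restrict (Iio (0 : ℝ) ×ˢ (univ : Set (EuclideanSpace ℝ (Fin 3))))) := by
    have := hsw.distributional.2.2.1.aestronglyMeasurable
    simpa [slab] using this
  have hVm := aestronglyMeasurable_profile hum hu
  have hPm := aestronglyMeasurable_pressureProfile hpm hp
  have hV3 : LocallyIntegrable (fun y => ‖V y‖ ^ 3) volume := locallyIntegrable_cube_profile hsw hum hu
  have hV2 : Integrable (fun y => ‖V y‖ ^ 2) volume :=
    integrable_norm_sq_of_lintegral_lt_top hVm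
      (lt_of_le_of_lt (lintegral_enorm_sq_profile_le_of_half hu hA) ENNReal.coe_lt_top)
  have hPw := profile_pressure_weight_of_gaugeD (ρ := 1 / 2) (by norm_num) (by norm_num) hpm hp hD
  have hBne : ENNReal.ofReal ((2 - 2 * (1 / 2 : ℝ)) / (2 + 1 / 2)) * (c : ℝ≥0∞) ≠ ⊤ :=
    ENNReal.mul_ne_top ENNReal.ofReal_ne_top ENNReal.coe_ne_top
  have hPV : LocallyIntegrable (fun y => |P y| * ‖V y‖) volume :=
    locallyIntegrable_abs_mul_norm_of_weight hPm hVm hV3 hBne hPw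
  -- the forward profile LEI of the class
  have hLEI := fun (σ : EuclideanSpace ℝ (Fin 3) → ℝ) (hσ : ContDiff ℝ (⊤ : ℕ∞) σ)
      (hσc : HasCompactSupport σ) (hσ0 : ∀ x, 0 ≤ σ x) =>
    selfSimilar_profile_energy_le_add_flux hsw hu hp hσ hσc hσ0
  -- sublinear (indeed bounded) growth of the profile
  have hM0 : 0 ≤ M := (norm_nonneg _).trans (hM 0)
  have hup : ∀ᵐ y ∂volume, (0 : ℝ) ≤ ‖y‖ → ‖V y‖ ≤ M * ‖y‖ ^ (1 - (1 : ℝ)) :=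
    Eventually.of_forall fun y _ => by simpa using hM y
  -- `P ∈ L¹_loc` and the weak Poisson equation, whence the Riesz representation at every scale
  have hP1 : LocallyIntegrable P volume := by
    rw [locallyIntegrable_iff]
    intro K' hK'
    obtain ⟨r, hKr⟩ := hK'.isBounded.subset_closedBall (0 : EuclideanSpace ℝ (Fin 3))
    have hr : 0 < |r| + 1 := by positivity
    haveI : IsFiniteMeasure (volume.restrict (ball (0 : EuclideanSpace ℝ (Fin 3)) (|r| + 1))) :=
      isFiniteMeasure_restrict.2 measure_ball_lt_top.ne
    have h32 : (1 : ℝ≥0∞) ≤ 3 / 2 := by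
      rw [ENNReal.le_div_iff_mul_le (Or.inl two_ne_zero) (Or.inl ENNReal.ofNat_ne_top)]; norm_num
    have hI : IntegrableOn P (ball (0 : EuclideanSpace ℝ (Fin 3)) (|r| + 1)) volume :=
      (memLp_threeHalves_ball_of_weight hPm hBne hPw hr).integrable h32
    exact hI.mono_set (hKr.trans (closedBall_subset_ball (by linarith [le_abs_self r])))
  have hPoisson := fun (θ : EuclideanSpace ℝ (Fin 3) → ℝ) (hθ : ContDiff ℝ (⊤ : ℕ∞) θ)
      (hθc : HasCompactSupport θ) =>
    profile_pressure_poisson hsw hum hu hp hV2.locallyIntegrable hP1 hθ hθc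
  set AP : ℝ := (ENNReal.ofReal ((2 - 2 * (1 / 2 : ℝ)) / (2 + 1 / 2)) * (c : ℝ≥0∞)).toReal ^ (2 / 3 : ℝ) *
    (volume.real (ball (0 : EuclideanSpace ℝ (Fin 3)) 1)) ^ (1 / 3 : ℝ) with hAP
  set AV : ℝ := (∫ y in closedBall (0 : EuclideanSpace ℝ (Fin 3)) |(0 : ℝ)|, ‖V y‖ ^ 3) +
    M * ∫ z, ‖V z‖ ^ 2 with hAV
  have hAP0 : 0 ≤ AP := by positivity
  have hPg : ∀ L : ℝ, 1 ≤ L → ∫ y in ball (0 : EuclideanSpace ℝ (Fin 3)) L, |P y| ≤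
      max AP AV * L ^ (3 - (4 / 3 : ℝ)) := by
    intro L hL
    rw [show (3 : ℝ) - 4 / 3 = 5 / 3 by norm_num]
    exact (setIntegral_abs_le_of_weight hPm hBne hPw hL).trans
      (mul_le_mul_of_nonneg_right (le_max_left _ _) (by positivity))
  have hVg : ∀ L : ℝ, 1 ≤ L → ∫ y in ball (0 : EuclideanSpace ℝ (Fin 3)) L, ‖V y‖ ^ 3 ≤
      max AP AV * L ^ (3 - (4 / 3 : ℝ)) := by
    intro L hL
    rw [show (3 : ℝ) - 4 / 3 = 5 / 3 by norm_num]
    exact (setIntegral_cube_le_of_sublinear hV2 hV3 le_rfl (by norm_num) hM0 hup hL).trans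
      (mul_le_mul_of_nonneg_right (le_max_right _ _) (by positivity))
  have hPR : ∀ R : ℝ, 1 ≤ R → ∀ᵐ y ∂volume, ‖y‖ < R / 2 →
      P y = rieszPressure ((ball (0 : EuclideanSpace ℝ (Fin 3)) R).indicator V) y +
        ∫ z in {z | R ≤ ‖z‖}, pressureKernel (y - z) (V z) :=
    fun R hR => pressure_ae_eq_scaleQ_of_poisson hVm hV2 hV3 hP1 hPoisson (σ := 4 / 3)
      (by norm_num) (by norm_num) (le_max_of_le_left hAP0) hPg hVg (by linarith)
  -- the shell energies drain like `L^{-4}`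
  obtain ⟨C, hC⟩ := shell_energy_decay_half hVm hV2 hV3 hPV hγ hLEI hPR one_pos le_rfl hM0 hup
    (ε := 1) one_pos
  have hC0 : 0 ≤ C := by
    have h := hC 1 le_rfl
    have h0 : 0 ≤ ∫ y in {y : EuclideanSpace ℝ (Fin 3) | (1 : ℝ) ≤ ‖y‖ ∧ ‖y‖ < 2 * 1}, ‖V y‖ ^ 2 :=
      setIntegral_nonneg (measurableSet_le measurable_const measurable_norm |>.inter
        (measurableSet_lt measurable_norm measurable_const)) fun y _ => by positivity
    simpa using h0.trans h
  have hshell : ∀ l : ℝ, 1 ≤ l →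
      ∫ x in {x | l ≤ ‖x‖ ∧ ‖x‖ < 2 * l}, ‖V x‖ ^ 2 ≤ C * l ^ (-(4 : ℝ)) := by
    intro l hl
    have h := hC l hl
    rwa [show (-(5 : ℝ) + 1) = -(4 : ℝ) by norm_num] at h
  -- the Kelvin lever: compactly supported vorticity
  rw [hγ] at hprof
  have hΩc : HasCompactSupport (curl V) :=
    hasCompactSupport_curl_of_shellDecay (γ := 2 / 5) rfl hV hK hM hprof hV2 hDV
      (by norm_num : (0 : ℝ) < 4) hC0 one_pos hshell
  rw [← hγ] at hprof
  exact selfSimilar_ae_eq_zero_of_hasCompactSupport_curl (ρ := 1 / 2) (by norm_num) u p H c V P hsw hH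
    hgauge hu hprof hΩc

end Summit.NavierStokesRegularity.NavierStokesRegularity.Theorems.PowerGaugeEulerLiouville.Kelvin

end
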